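import Mathlib

/-!
# Solo-blind kernel #280 — certified quadrature of a line integral from piecewise sup bounds

The last composition step of [A′](a) (ENGINE-L-SPEC §13(a), §16(q)(ii)): the shifted-line energy
`Q0′ = (2π)⁻¹ ∫_ℝ ‖R(σ+iω)‖² dω` of #266/#273 is bounded by a FINITE CERTIFIED SUM once the boxes
give `‖R‖ ≤ v_k` on consecutive ω-intervals `[w_k, w_{k+1}]` and the two tails are bounded explicitly
(#263 `tail_sq_integral`):
* `interval_piece_le`: `f ≤ M` on `[a,b]` ⇒ `∫_a^b f ≤ M (b − a)`;
* `partition_sum_le`: over a monotone partition `w_0 ≤ … ≤ w_n`, `∫_{w_0}^{w_n} f ≤ Σ_k M_k (w_{k+1} − w_k)`;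
* `line_quadrature`: `∫_ℝ f ≤ T₋ + Σ_k M_k (w_{k+1} − w_k) + T₊` for an integrable continuous `f`
  with tail bounds `∫_{(-∞,w_0]} f ≤ T₋`, `∫_{(w_n,∞)} f ≤ T₊`;
* `sq_le_of_abs_le`: the per-piece bound `M_k = v_k²` from `|g| ≤ v_k`.
-/

namespace Summit.AnomalousDissipation.SoloBlind.LineQuadrature

open MeasureTheory Set intervalIntegral

/-- One piece: `f ≤ M` on `[a,b]` (`a ≤ b`) ⇒ `∫_a^b f ≤ M·(b−a)`. -/
theorem interval_piece_le {f : ℝ → ℝ} (hf : Continuous f) {a b M : ℝ} (hab : a ≤ b)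
    (hM : ∀ x ∈ Icc a b, f x ≤ M) : ∫ x in a..b, f x ≤ M * (b - a) := by
  have h := intervalIntegral.integral_mono_on hab (hf.intervalIntegrable a b)
    (intervalIntegrable_const (c := M) (μ := volume) (a := a) (b := b)) hM
  rw [intervalIntegral.integral_const, smul_eq_mul] at h
  linarith

/-- **Partition sum**: over `w_0 ≤ w_1 ≤ … ≤ w_n` with `f ≤ M_k` on `[w_k, w_{k+1}]`,
`∫_{w_0}^{w_n} f ≤ Σ_{k<n} M_k (w_{k+1} − w_k)`. -/
theorem partition_sum_le {f : ℝ → ℝ} (hf : Continuous f) {w M : ℕ → ℝ} {n : ℕ}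
    (hmono : ∀ k < n, w k ≤ w (k + 1))
    (hM : ∀ k < n, ∀ x ∈ Icc (w k) (w (k + 1)), f x ≤ M k) :
    ∫ x in (w 0)..(w n), f x ≤ ∑ k ∈ Finset.range n, M k * (w (k + 1) - w k) := by
  rw [← sum_integral_adjacent_intervals (fun k _ => hf.intervalIntegrable (w k) (w (k + 1)))]
  refine Finset.sum_le_sum fun k hk => ?_
  rw [Finset.mem_range] at hk
  exact interval_piece_le hf (hmono k hk) (hM k hk)

/-- **Line quadrature**: `∫_ℝ f ≤ T₋ + Σ_k M_k (w_{k+1} − w_k) + T₊`. -/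
theorem line_quadrature {f : ℝ → ℝ} (hf : Continuous f) (hint : Integrable f) {w M : ℕ → ℝ}
    {n : ℕ} (hmono : ∀ k < n, w k ≤ w (k + 1))
    (hM : ∀ k < n, ∀ x ∈ Icc (w k) (w (k + 1)), f x ≤ M k) {Tlo Thi : ℝ}
    (hlo : ∫ x in Iic (w 0), f x ≤ Tlo) (hhi : ∫ x in Ioi (w n), f x ≤ Thi) :
    ∫ x, f x ≤ Tlo + (∑ k ∈ Finset.range n, M k * (w (k + 1) - w k)) + Thi := by
  have h1 : (∫ x in Iic (w n), f x) + (∫ x in Ioi (w n), f x) = ∫ x, f x :=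
    integral_Iic_add_Ioi hint.integrableOn hint.integrableOn
  have h2 : (∫ x in Iic (w n), f x) - (∫ x in Iic (w 0), f x) = ∫ x in (w 0)..(w n), f x :=
    integral_Iic_sub_Iic hint.integrableOn hint.integrableOn
  have h3 := partition_sum_le hf hmono hM
  linarith

/-- Per-piece bound for a squared modulus: `|g| ≤ v` on the piece ⇒ `g² ≤ v²` there. -/
theorem sq_le_of_abs_le {g : ℝ → ℝ} {a b v : ℝ} (hv : ∀ x ∈ Icc a b, |g x| ≤ v) :
    ∀ x ∈ Icc a b, g x ^ 2 ≤ v ^ 2 := fun x hx => by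
  have h := hv x hx
  have hv0 : 0 ≤ v := le_trans (abs_nonneg _) h
  calc g x ^ 2 = |g x| ^ 2 := (sq_abs _).symm
    _ ≤ v ^ 2 := pow_le_pow_left₀ (abs_nonneg _) h 2

/-- The same for a norm (`f = ‖R(σ+iω)‖²`): `‖R‖ ≤ v` on the piece ⇒ `‖R‖² ≤ v²`. -/
theorem norm_sq_le_of_norm_le {F : Type*} [SeminormedAddCommGroup F] {R : ℝ → F} {a b v : ℝ}
    (hv : ∀ x ∈ Icc a b, ‖R x‖ ≤ v) : ∀ x ∈ Icc a b, ‖R x‖ ^ 2 ≤ v ^ 2 := fun x hx =>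
  pow_le_pow_left₀ (norm_nonneg _) (hv x hx) 2

end Summit.AnomalousDissipation.SoloBlind.LineQuadrature
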